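import Summits.QuantumFields.YangMills.Theorems.BalabanUVNodesN09CentralWindowInverseContinuous
import Literature.MeasureTheory.Function.MeasurableInvFunOn

/-!
# NODE N09 [B12] — THE SHARP PACKAGING OF ROAD A′'s PER-BOND INVERSION DATA FROM FORWARD JACOBIAN LAWS: the density formula `jd = (jac ∘ ϑ)⁻¹`, its non-vanishing on the
# image windows, closed image graphs, compact image windows, and JOINT CONTINUITY of the inverses and of the triangular chart — all in ONE `obtain`

Cell `pub-ymgap` (YM-PLAN Track A), width seat `pub-ymgap-dag-n09-w6` g4, FILE 4; helper of K1⁹ `StabilityBRunRowsAtRecordR13SepCoPHV` = stmt-QuantumFields-27364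
(`--supports`, `--as helper`, count-neutral).  [I] = [Balaban1987RG1].  CONSUMED BY NAME (nothing modified): this seat's g3 `…N09CentralWindowAtRecord`
(`measurableSet_centralWindow`, `centralWindow_extend`, `avgFun_update_centralBond_injOn_centralWindow`; ★★★ `exists_perBondCharts_of_forwardLaws` is the 10-clause
packaging this file SHARPENS — a new leaf, the landed file untouched), g3 `…N09PerBondChartsOfInjectivityWindows.measurable_oneVariable_record`, g3
`Literature.MeasureTheory.Function.exists_measurable_fibrewiseInverse` (Lusin–Souslin), g3 `T4TriangularFibredChart.restrict_eq_map_withDensity_of_leftInvOn` (inverse law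
from forward law), and this seat's g4 FILE 2 `…N09CentralWindowInverseContinuous` (closed image graphs, compact image windows, ★★★ joint continuity of every left inverse and
of the triangular chart).

WHY.  `exists_perBondCharts_of_forwardLaws` hides the inverse density behind an `∃`; its consumers (dag-n09-w5 g4's tower, this seat's FILE 3 `…N09TowerBasePointSocketsOfOpenness`
hypothesis (P)) need two more facts that are TRUE OF THE CONSTRUCTION but not exported: the formula `jd_c(U, v) = (jac_c(U, ϑ_c(U, v)))⁻¹` (so continuity ∕ positivity of `jd`
REDUCE to those of the forward density `jac` — dag-n09-w4 g5's INTENT-6 currency — and of `ϑ` — FILE 2) and its corollary `jd_c(U, v) ≠ 0` on `T_c(U)` (= (P)).  This file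
re-runs the construction at the central `α`-windows and exports, per level `j < K`, SIXTEEN clauses (and `continuousOn_inverseDensity_of_formula` turns (Q) + fibrewise
continuity of the FORWARD density into (J′), the fibrewise continuity of `jd` on the image windows): the ten of `exists_perBondCharts_of_forwardLaws` VERBATIM, then (Q) the
density formula, (P) non-vanishing on the image windows, (C1) every image graph `{(U, v) | v ∈ T_c(U)}` is CLOSED, (C2) every `ϑ_c` is JOINTLY CONTINUOUS on it, (C3) the
triangular chart `(V, z) ↦ extend β (c ↦ ϑ_c(z, V c)) z` is JOINTLY CONTINUOUS on `{(V, z) | ∀ c, V c ∈ T_c(z)}`, (C4) every image window is COMPACT.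

HONEST FRAMING.  Count-neutral kernel bookkeeping BY NAME; the forward laws `hfwd` with their densities `jac` (jointly measurable, non-vanishing on the windows) are HYPOTHESES
(dag-n09-w4 g5's INTENT-6 is their announced supplier); NO Jacobian law proved here, NO support clause, NO nullity, NO openness; nothing of Bałaban's estimates asserted; `hreg` NOT
discharged; N09 NOT discharged; conjunct 1 (Lemma 4) ∕ FLAG №7 untouched; K0⁷ ∕ K1⁹ ∕ K3⁸ NOT closed; counts unmoved (typed 28∕28 · discharged 5∕28); no summit statement is proved
by this seat; one finite four-torus programme at fixed `ε` — R4 closes the conditional rung `BalabanLadder.UV` only; NOT continuum ∕ ℝ⁴ ∕ OS; the Yang–Mills mass gap (Clay) is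
NOT proved by any of this.
-/

noncomputable section

open scoped Matrix.Norms.L2Operator

namespace Summit.QuantumFields.YangMills.BalabanUVNodes.N09PerBondChartsOfForwardLawsSharp

open MeasureTheory Set Function Filter Topology
open scoped ENNReal NNReal
open Literature.MathematicalPhysics.QuantumFieldTheory.Balaban1983to89
open Literature.MathematicalPhysics.QuantumFieldTheory.Balaban1983to89.T4Continuum (T4Family)
open Literature.MathematicalPhysics.QuantumFieldTheory.Balaban1983to89.BlockAveraging (Idx)
open Literature.MathematicalPhysics.QuantumFieldTheory.Balaban1983to89.BlockAveragingHaarAC (centralBond pre post)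
open Literature.MathematicalPhysics.QuantumFieldTheory.Balaban1983to89.BlockAveragingEMLHaarAC (fibreFamily offCard)
open Literature.MathematicalPhysics.QuantumFieldTheory.Balaban1983to89.ExpMeanLog (deltaSU)
open Literature.MathematicalPhysics.QuantumFieldTheory.Balaban1983to89.Node00
open Literature.MathematicalPhysics.QuantumFieldTheory.Balaban1983to89.T4TriangularFibredChart (restrict_eq_map_withDensity_of_leftInvOn)
open Literature.MeasureTheory.Function (exists_measurable_fibrewiseInverse)
open Summit.QuantumFields.YangMills.BalabanUVNodes.N09CentralWindowAtRecord
  (measurableSet_centralWindow centralWindow_extend avgFun_update_centralBond_injOn_centralWindow)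
open Summit.QuantumFields.YangMills.BalabanUVNodes.N09PerBondChartsOfInjectivityWindows (measurable_oneVariable_record)
open Summit.QuantumFields.YangMills.BalabanUVNodes.N09LiftInvariance29AtRecord (succ_le_range_of_lt)
open Summit.QuantumFields.YangMills.BalabanUVNodes.N09CentralWindowInverseContinuous
  (isClosed_imageWindowGraph_record continuousOn_inverse_of_leftInverse_record continuousOn_triChart_of_leftInverse_record isCompact_imageWindow_record)

variable {F : T4Family} {N : ℕ} [NeZero N] {K j : ℕ}

/-- ★★★ **THE SHARP PACKAGING: per-bond inversion data at the record from forward Jacobian laws on the central `α`-windows, with the density formula, its non-vanishing, closed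
image graphs, compact image windows and joint continuity of the inverses and of the triangular chart** (one level `j < K`; `0 ≤ α ≤ 1∕24`, `α < δ_N`,
`offCard c∕|Idx| + 150·α < 1`).  Clauses 1–10 are those of `…N09CentralWindowAtRecord.exists_perBondCharts_of_forwardLaws` VERBATIM (window measurable and blind, `T`-graph
measurable, `ϑ`, `jd` jointly measurable, right inverse on `T`, inverse law, `T =` image window, left inverse on `Ωα`, `ϑ ∈ Ωα` on `T`); then (Q) `jd_c(U,v) = (jac_c(U, ϑ_c(U,v)))⁻¹`,
(P) `jd_c(U,v) ≠ 0` for `v ∈ T_c(U)`, (C1) `{(U,v) | v ∈ T_c(U)}` closed, (C2) `(U,v) ↦ ϑ_c(U,v)` continuous on it, (C3) `(V,z) ↦ extend β (c ↦ ϑ_c(z, V c)) z` continuous on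
`{(V,z) | ∀ c, V c ∈ T_c(z)}`, (C4) `T_c(U)` compact.  CONDITIONAL on the displayed forward laws; nothing of Bałaban's asserted.
[cite: Balaban1987RG1, p.259, (0.4) p.253 and (2.9)–(2.10) pp.266–267; Kechris1995, Thm 15.1 and Cor 15.2; BourbakiGT1, Ch. I §10 no. 2, Thm 1 Cor. 5] -/
theorem exists_perBondCharts_of_forwardLaws_sharp (hj : j < K) {α : ℝ} (hα0 : 0 ≤ α) (hα : α ≤ 1 / 24)
    (hαδ : α < deltaSU (Fin N)) (hgap : ∀ c : PBond (F.P K) (j + 1), (offCard c : ℝ) / (Fintype.card (Idx (F.P K)) : ℝ) + 150 * α < 1)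
    (jac : PBond (F.P K) (j + 1) → GaugeField (F.P K) j (SU N) → SU N → ℝ≥0)
    (hjacm : ∀ c, Measurable fun p : GaugeField (F.P K) j (SU N) × SU N => jac c p.1 p.2)
    (hjac0 : ∀ c U g, (∀ i : Idx (F.P K), dist1 (fibreFamily U c (pre U c * g * post U c) i) ≤ α) → jac c U g ≠ 0)
    (hfwd : ∀ c U, (HaarData.haar : Measure (SU N)).restrict
        ((fun g => (avOfRecord F N K j).avg (Function.update U (centralBond c) g) c) ''
          {g : SU N | ∀ i : Idx (F.P K), dist1 (fibreFamily U c (pre U c * g * post U c) i) ≤ α}) =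
      (((HaarData.haar : Measure (SU N)).restrict {g : SU N | ∀ i : Idx (F.P K), dist1 (fibreFamily U c (pre U c * g * post U c) i) ≤ α}).withDensity
          fun g => (jac c U g : ℝ≥0∞)).map (fun g => (avOfRecord F N K j).avg (Function.update U (centralBond c) g) c)) :
    ∃ (T : PBond (F.P K) (j + 1) → GaugeField (F.P K) j (SU N) → Set (SU N))
      (ϑ : PBond (F.P K) (j + 1) → GaugeField (F.P K) j (SU N) → SU N → SU N)
      (jd : PBond (F.P K) (j + 1) → GaugeField (F.P K) j (SU N) → SU N → ℝ≥0),
      (∀ c, MeasurableSet {p : GaugeField (F.P K) j (SU N) × SU N | p.2 ∈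
          {g : SU N | ∀ i : Idx (F.P K), dist1 (fibreFamily p.1 c (pre p.1 c * g * post p.1 c) i) ≤ α}}) ∧
      (∀ c (U : GaugeField (F.P K) j (SU N)) (g' : PBond (F.P K) (j + 1) → SU N),
          {g : SU N | ∀ i : Idx (F.P K), dist1 (fibreFamily (extend centralBond g' U) c
              (pre (extend centralBond g' U) c * g * post (extend centralBond g' U) c) i) ≤ α} =
            {g : SU N | ∀ i : Idx (F.P K), dist1 (fibreFamily U c (pre U c * g * post U c) i) ≤ α}) ∧
      (∀ c, MeasurableSet {p : GaugeField (F.P K) j (SU N) × SU N | p.2 ∈ T c p.1}) ∧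
      (∀ c, Measurable fun p : GaugeField (F.P K) j (SU N) × SU N => ϑ c p.1 p.2) ∧
      (∀ c, Measurable fun p : GaugeField (F.P K) j (SU N) × SU N => jd c p.1 p.2) ∧
      (∀ c U, ∀ v ∈ T c U, (avOfRecord F N K j).avg (Function.update U (centralBond c) (ϑ c U v)) c = v) ∧
      (∀ c U, (HaarData.haar : Measure (SU N)).restrict {g : SU N | ∀ i : Idx (F.P K), dist1 (fibreFamily U c (pre U c * g * post U c) i) ≤ α} =
        (((HaarData.haar : Measure (SU N)).restrict (T c U)).withDensity fun v => (jd c U v : ℝ≥0∞)).map (ϑ c U)) ∧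
      (∀ c U, T c U = (fun g => (avOfRecord F N K j).avg (Function.update U (centralBond c) g) c) ''
          {g : SU N | ∀ i : Idx (F.P K), dist1 (fibreFamily U c (pre U c * g * post U c) i) ≤ α}) ∧
      (∀ c U g, (∀ i : Idx (F.P K), dist1 (fibreFamily U c (pre U c * g * post U c) i) ≤ α) →
          ϑ c U ((avOfRecord F N K j).avg (Function.update U (centralBond c) g) c) = g) ∧
      (∀ c U, ∀ v ∈ T c U, ∀ i : Idx (F.P K), dist1 (fibreFamily U c (pre U c * ϑ c U v * post U c) i) ≤ α) ∧
      (∀ c U v, jd c U v = (jac c U (ϑ c U v))⁻¹) ∧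
      (∀ c U, ∀ v ∈ T c U, jd c U v ≠ 0) ∧
      (∀ c, IsClosed {q : GaugeField (F.P K) j (SU N) × SU N | q.2 ∈ T c q.1}) ∧
      (∀ c, ContinuousOn (fun q : GaugeField (F.P K) j (SU N) × SU N => ϑ c q.1 q.2) {q : GaugeField (F.P K) j (SU N) × SU N | q.2 ∈ T c q.1}) ∧
      ContinuousOn (fun p : (PBond (F.P K) (j + 1) → SU N) × GaugeField (F.P K) j (SU N) =>
          (extend centralBond (fun c => ϑ c p.2 (p.1 c)) p.2 : GaugeField (F.P K) j (SU N)))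
        {p : (PBond (F.P K) (j + 1) → SU N) × GaugeField (F.P K) j (SU N) | ∀ c, p.1 c ∈ T c p.2} ∧
      (∀ c U, IsCompact (T c U)) := by
  have hj' : j + 1 ≤ (F.P K).m + (F.P K).K := succ_le_range_of_lt hj
  -- the window: jointly measurable, injectivity
  have hmeas : ∀ c : PBond (F.P K) (j + 1), MeasurableSet {p : GaugeField (F.P K) j (SU N) × SU N |
      p.2 ∈ {g : SU N | ∀ i : Idx (F.P K), dist1 (fibreFamily p.1 c (pre p.1 c * g * post p.1 c) i) ≤ α}} :=
    fun c => measurableSet_centralWindow c α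
  have hinj : ∀ (c : PBond (F.P K) (j + 1)) (U : GaugeField (F.P K) j (SU N)),
      InjOn (fun g => (avOfRecord F N K j).avg (Function.update U (centralBond c) g) c)
        {g : SU N | ∀ i : Idx (F.P K), dist1 (fibreFamily U c (pre U c * g * post U c) i) ≤ α} :=
    fun c U => avgFun_update_centralBond_injOn_centralWindow hj' U c hα0 hα hαδ (hgap c)
  -- per bond: Lusin–Souslin (ONE jointly measurable inverse)
  have key : ∀ c : PBond (F.P K) (j + 1), ∃ θ : GaugeField (F.P K) j (SU N) × SU N → SU N, Measurable θ ∧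
      (∀ U, ∀ g ∈ {g : SU N | ∀ i : Idx (F.P K), dist1 (fibreFamily U c (pre U c * g * post U c) i) ≤ α},
        θ (U, (avOfRecord F N K j).avg (Function.update U (centralBond c) g) c) = g) ∧
      (∀ U, ∀ v ∈ (fun g => (avOfRecord F N K j).avg (Function.update U (centralBond c) g) c) ''
          {g : SU N | ∀ i : Idx (F.P K), dist1 (fibreFamily U c (pre U c * g * post U c) i) ≤ α},
        (avOfRecord F N K j).avg (Function.update U (centralBond c) (θ (U, v))) c = v ∧
          θ (U, v) ∈ {g : SU N | ∀ i : Idx (F.P K), dist1 (fibreFamily U c (pre U c * g * post U c) i) ≤ α}) := fun c =>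
    (exists_measurable_fibrewiseInverse (Ψ := fun p : GaugeField (F.P K) j (SU N) × SU N =>
      (avOfRecord F N K j).avg (Function.update p.1 (centralBond c) p.2) c)
      (Ω := fun U => {g : SU N | ∀ i : Idx (F.P K), dist1 (fibreFamily U c (pre U c * g * post U c) i) ≤ α})
      (measurable_oneVariable_record c) (hmeas c) (hinj c)).2
  have keyT : ∀ c : PBond (F.P K) (j + 1), MeasurableSet {p : GaugeField (F.P K) j (SU N) × SU N |
      p.2 ∈ (fun g => (avOfRecord F N K j).avg (Function.update p.1 (centralBond c) g) c) ''
        {g : SU N | ∀ i : Idx (F.P K), dist1 (fibreFamily p.1 c (pre p.1 c * g * post p.1 c) i) ≤ α}} := fun c =>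
    (exists_measurable_fibrewiseInverse (Ψ := fun p : GaugeField (F.P K) j (SU N) × SU N =>
      (avOfRecord F N K j).avg (Function.update p.1 (centralBond c) p.2) c)
      (Ω := fun U => {g : SU N | ∀ i : Idx (F.P K), dist1 (fibreFamily U c (pre U c * g * post U c) i) ≤ α})
      (measurable_oneVariable_record c) (hmeas c) (hinj c)).1
  choose θ hθm hleft hright using key
  -- the three families
  have hTdef : ∀ (c : PBond (F.P K) (j + 1)) (U : GaugeField (F.P K) j (SU N)),
      (fun g => (avOfRecord F N K j).avg (Function.update U (centralBond c) g) c) ''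
          {g : SU N | ∀ i : Idx (F.P K), dist1 (fibreFamily U c (pre U c * g * post U c) i) ≤ α} =
        (fun g => (avOfRecord F N K j).avg (Function.update U (centralBond c) g) c) ''
          {g : SU N | ∀ i : Idx (F.P K), dist1 (fibreFamily U c (pre U c * g * post U c) i) ≤ α} := fun _ _ => rfl
  have hleft' : ∀ (c : PBond (F.P K) (j + 1)) (U : GaugeField (F.P K) j (SU N)) (g : SU N),
      (∀ i : Idx (F.P K), dist1 (fibreFamily U c (pre U c * g * post U c) i) ≤ α) →
        (fun v => θ c (U, v)) ((avOfRecord F N K j).avg (Function.update U (centralBond c) g) c) = g := fun c U g hg => hleft c U g hg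
  refine ⟨fun c U => (fun g => (avOfRecord F N K j).avg (Function.update U (centralBond c) g) c) ''
      {g : SU N | ∀ i : Idx (F.P K), dist1 (fibreFamily U c (pre U c * g * post U c) i) ≤ α},
    fun c U v => θ c (U, v), fun c U v => (jac c U (θ c (U, v)))⁻¹,
    hmeas, fun c U g' => centralWindow_extend hj' c α U g', keyT, fun c => hθm c, fun c => ?_, fun c U v hv => (hright c U v hv).1, fun c U => ?_,
    fun c U => rfl, fun c U g hg => hleft c U g hg, fun c U v hv => (hright c U v hv).2, fun c U v => rfl, fun c U v hv => ?_,
    fun c => isClosed_imageWindowGraph_record hj hαδ _ hTdef c,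
    fun c => continuousOn_inverse_of_leftInverse_record hj hαδ _ (fun c U v => θ c (U, v)) hTdef hleft' c,
    continuousOn_triChart_of_leftInverse_record hj hαδ _ (fun c U v => θ c (U, v)) hTdef hleft',
    fun c U => isCompact_imageWindow_record hj hαδ _ hTdef c U⟩
  · -- `jd` jointly measurable
    exact ((hjacm c).comp (measurable_fst.prodMk (hθm c))).inv
  · -- the inverse law from the forward law
    have hΩU : MeasurableSet {g : SU N | ∀ i : Idx (F.P K), dist1 (fibreFamily U c (pre U c * g * post U c) i) ≤ α} :=
      (measurable_const.prodMk measurable_id) (hmeas c)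
    have hψ : Measurable fun g => (avOfRecord F N K j).avg (Function.update U (centralBond c) g) c :=
      (measurable_pi_apply c).comp ((avOfRecord_measurable F N K j).comp (measurable_update U))
    have hθU : Measurable fun v => θ c (U, v) := (hθm c).comp (measurable_const.prodMk measurable_id)
    have hjacU : Measurable fun g => (jac c U g : ℝ≥0∞) := measurable_coe_nnreal_ennreal.comp ((hjacm c).comp (measurable_const.prodMk measurable_id))
    have h := restrict_eq_map_withDensity_of_leftInvOn (ν := (HaarData.haar : Measure (SU N))) hΩU hψ hθU (hleft c U) hjacU
      (fun g hg => by exact_mod_cast hjac0 c U g hg) (fun g _ => ENNReal.coe_ne_top) (hfwd c U)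
    rw [h]
    congr 1
    refine withDensity_congr_ae ?_
    filter_upwards [ae_restrict_mem (keyT c |> fun h => (measurable_const.prodMk measurable_id) h)] with v hv
    rw [ENNReal.coe_inv (hjac0 c U _ ((hright c U v hv).2))]
  · -- (P) non-vanishing on the image window
    exact inv_ne_zero (hjac0 c U _ ((hright c U v hv).2))


/-- ★ **(J′) FROM THE FORWARD DENSITY'S FIBREWISE CONTINUITY.**  If the inverse density has the formula `jd_c(U, v) = (jac_c(U, ϑ_c(U, v)))⁻¹` ((Q) of the sharp packaging),
the inverse `ϑ_c(U, ·)` is continuous on the image window `T_c(U)` with values in the window ((C2) and clause 10), and the FORWARD density `jac_c(U, ·)` is continuous and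
non-vanishing on the window, then `jd_c(U, ·)` is continuous on `T_c(U)` — the (J′) input of the a.e. sockets (`ℝ≥0` has continuous inversion away from `0`).
[cite: Balaban1987RG1, (2.10) p.267 (bookkeeping)] -/
theorem continuousOn_inverseDensity_of_formula {α : ℝ}
    (T : PBond (F.P K) (j + 1) → GaugeField (F.P K) j (SU N) → Set (SU N))
    (ϑ : PBond (F.P K) (j + 1) → GaugeField (F.P K) j (SU N) → SU N → SU N)
    (jd jac : PBond (F.P K) (j + 1) → GaugeField (F.P K) j (SU N) → SU N → ℝ≥0)
    (hQ : ∀ c U v, jd c U v = (jac c U (ϑ c U v))⁻¹)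
    (hθT : ∀ c U, ∀ v ∈ T c U, ∀ i : Idx (F.P K), dist1 (fibreFamily U c (pre U c * ϑ c U v * post U c) i) ≤ α)
    (hθc : ∀ c U, ContinuousOn (ϑ c U) (T c U))
    (hjac0 : ∀ c U g, (∀ i : Idx (F.P K), dist1 (fibreFamily U c (pre U c * g * post U c) i) ≤ α) → jac c U g ≠ 0)
    (hjacc : ∀ c U, ContinuousOn (jac c U) {g : SU N | ∀ i : Idx (F.P K), dist1 (fibreFamily U c (pre U c * g * post U c) i) ≤ α}) :
    ∀ c U, ContinuousOn (jd c U) (T c U) := by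
  intro c U
  have hcomp : ContinuousOn (fun v => jac c U (ϑ c U v)) (T c U) :=
    (hjacc c U).comp (hθc c U) fun v hv => hθT c U v hv
  have hinv : ContinuousOn (fun v => (jac c U (ϑ c U v))⁻¹) (T c U) :=
    hcomp.inv₀ fun v hv => hjac0 c U _ (hθT c U v hv)
  refine hinv.congr fun v _ => ?_
  exact hQ c U v

end Summit.QuantumFields.YangMills.BalabanUVNodes.N09PerBondChartsOfForwardLawsSharp

end
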